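import Literature.Geometry.Manifold.LocalDiffeoOnOpen
import Mathlib.Analysis.InnerProductSpace.Calculus
import Mathlib.Analysis.SpecialFunctions.Sqrt
import Mathlib.Analysis.Complex.RealDeriv
import Mathlib.Analysis.Calculus.Deriv.MeanValue
import Mathlib.Analysis.Calculus.Deriv.Inv
import Mathlib.Analysis.Calculus.Deriv.Prod
import Mathlib.Analysis.Calculus.Deriv.Shift
import Mathlib.Analysis.Calculus.Deriv.Mul
import Mathlib.LinearAlgebra.FiniteDimensional.Basic
import Mathlib.Topology.Algebra.Module.FiniteDimension
import HarnessLib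

/-!
# Radial collars of a planar potential, I: the core straightening map

Topic `Literature/Topology/FourManifolds`; part of the proof of the named fact
`Literature.Topology.FourManifolds.pictureSurgeryPresentation` (`MMSWPictureSurgery.lean`; Kirby,
*The Topology of 4-Manifolds*, LNM 1374 (1989), Ch. I §2, Lemma 2.1).  Everything here is proved;
no named fact is introduced.

This is the abstract analytic package used near EACH of the `k + 1` core circles of the model
boundary `M_k = {g_k(z) + |w|² = 1} ⊆ ℂ × ℂ` (the `k` inner cores over the boundary curves
`Γ_j` of the planar domain about the holes `c_j`, and the outer core, which after the explicit
change of planar coordinates of `MMSWPictureOuterChart` looks exactly the same).  The data are a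
centre `c ∈ ℂ` and a real function `ĝ` on the plane which, on an annulus about `c`, is smooth
with NEGATIVE radial derivative.  For the hypersurface `M̂ = {ĝ(z) + |w|² = 1}` we introduce the
**core straightening map**

`Θᴬ(z, w) = ((ĝ(z) + |w|²) · u_c(z), w)`, `u_c(z) = (z − c)/|z − c|`,

and prove that its derivative is injective wherever the radial derivative of `ĝ` does not vanish
(`injective_fderiv_thetaA`: the kernel computation `DΘᴬ h = 0 ⇒ h = 0` done with directional
derivatives along lines), that it is injective on the collar (`injOn_thetaA`, radial strict
monotonicity), hence — by the inverse function theorem on an open set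
(`Literature.Geometry.Manifold.contDiffOn_invFunOn_of_forall_hasStrictFDerivAt_equiv`) — a
diffeomorphism of the open collar onto an open set with smooth inverse
(`isOpen_image_thetaA`, `contDiffOn_invFunOn_thetaA`).  Since `Θᴬ(M̂) = {|ζ| = 1}`, the inverse
restricted to `𝕊¹ × (small disc)` is a smooth chart of `M̂` about its core circle `{w = 0}` in
which the core circle is `𝕊¹ × {0}` and `w` is the normal coordinate — the chart in which the
compressed standard picture extends smoothly over the core.

## References

* R. Kirby, *The Topology of 4-Manifolds*, LNM 1374 (1989), Ch. I §2. [Kirby1989]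
* J. M. Lee, *Introduction to Smooth Manifolds*, 2nd ed. (2013), Thm. 4.5 (inverse function
  theorem). [LeeSmoothManifolds2013]
-/

open scoped Topology Real ComplexConjugate ContDiff
open Function Set

noncomputable section

namespace Literature.Topology.FourManifolds

namespace MMSW

/-! ## Directional derivatives along lines -/

section LineDeriv

variable {E F : Type*} [NormedAddCommGroup E] [NormedSpace ℝ E] [NormedAddCommGroup F]
  [NormedSpace ℝ F]

/-- The derivative of `f` along the line `t ↦ x + t v` at `t = 0` is `f'(x) v`. [folklore] -/
theorem hasDerivAt_comp_line {f : E → F} {x : E} {f' : E →L[ℝ] F} (hf : HasFDerivAt f f' x)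
    (v : E) : HasDerivAt (fun t : ℝ ↦ f (x + t • v)) (f' v) 0 := by
  have hl : HasDerivAt (fun t : ℝ ↦ x + t • v) v 0 := by
    simpa using ((hasDerivAt_id (0 : ℝ)).smul_const v).const_add x
  exact hf.comp_hasDerivAt_of_eq (0 : ℝ) hl (by simp)

/-- **Kernel criterion by lines**: if every direction `v` along which `f` has vanishing
directional derivative is zero, the derivative of `f` is injective. [folklore] -/
theorem injective_of_hasDerivAt_line {f : E → F} {x : E} {f' : E →L[ℝ] F} (hf : HasFDerivAt f f' x)
    (h : ∀ v : E, HasDerivAt (fun t : ℝ ↦ f (x + t • v)) 0 0 → v = 0) : Injective f' := by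
  refine (injective_iff_map_eq_zero f').2 fun v hv ↦ h v ?_
  have := hasDerivAt_comp_line hf v
  rwa [hv] at this

end LineDeriv

/-! ## The inverse function theorem on an open set, fderiv form -/

section Straighten

variable {E : Type*} [NormedAddCommGroup E] [NormedSpace ℝ E] [FiniteDimensional ℝ E]

/-- **Straightening**: an injective smooth map of an open set of a finite-dimensional space into
itself whose derivative is everywhere injective has open image and a smooth inverse on it.
[cite: LeeSmoothManifolds2013, Thm. 4.5] -/
theorem isOpen_image_and_contDiffOn_invFunOn [Nonempty E] {f : E → E} {U : Set E}
    (hU : IsOpen U) (hf : ContDiffOn ℝ ∞ f U) (hinj : InjOn f U)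
    (hd : ∀ x ∈ U, Injective (fderiv ℝ f x)) :
    IsOpen (f '' U) ∧ ContDiffOn ℝ ∞ (invFunOn f U) (f '' U) := by
  have : CompleteSpace E := FiniteDimensional.complete ℝ E
  have hd' : ∀ p ∈ U, ∃ L : E ≃L[ℝ] E, HasStrictFDerivAt f (L : E →L[ℝ] E) p := by
    intro p hp
    have hfp : ContDiffAt ℝ ∞ f p := hf.contDiffAt (hU.mem_nhds hp)
    have hstrict : HasStrictFDerivAt f (fderiv ℝ f p) p := hfp.hasStrictFDerivAt (by simp)
    set L := (LinearEquiv.ofInjectiveEndo (fderiv ℝ f p).toLinearMap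
      (hd p hp)).toContinuousLinearEquiv with hL
    have hLe : (L : E →L[ℝ] E) = fderiv ℝ f p := by ext v; rfl
    exact ⟨L, by rw [hLe]; exact hstrict⟩
  exact ⟨Literature.Geometry.Manifold.isOpen_image_of_forall_hasStrictFDerivAt_equiv hU hd',
    Literature.Geometry.Manifold.contDiffOn_invFunOn_of_forall_hasStrictFDerivAt_equiv hU hf
      (by simp) hinj hd'⟩

end Straighten

/-! ## The unit radial field about a centre -/

/-- **The unit radial field** `u_c(z) = (z − c)/|z − c|` about the centre `c` (junk `0` at `c`).
[folklore] -/
def unitDir (c z : ℂ) : ℂ := ((‖z - c‖⁻¹ : ℝ) : ℂ) * (z - c)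

variable {c z : ℂ}

/-- `|u_c(z)| = 1` off the centre. [folklore] -/
theorem norm_unitDir (h : z ≠ c) : ‖unitDir c z‖ = 1 := by
  have hn : ‖z - c‖ ≠ 0 := norm_ne_zero_iff.2 (sub_ne_zero.2 h)
  rw [unitDir, norm_mul, Complex.norm_real, norm_inv, norm_norm, inv_mul_cancel₀ hn]

/-- `|z − c| · u_c(z) = z − c`. [folklore] -/
theorem norm_mul_unitDir (c z : ℂ) : ((‖z - c‖ : ℝ) : ℂ) * unitDir c z = z - c := by
  by_cases h : z = c
  · simp [unitDir, h]
  · have hn : ‖z - c‖ ≠ 0 := norm_ne_zero_iff.2 (sub_ne_zero.2 h)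
    rw [unitDir, ← mul_assoc, ← Complex.ofReal_mul, mul_inv_cancel₀ hn, Complex.ofReal_one, one_mul]

/-- `z = c + |z − c| · u_c(z)`. [folklore] -/
theorem eq_centre_add_norm_mul_unitDir (c z : ℂ) : z = c + ((‖z - c‖ : ℝ) : ℂ) * unitDir c z := by
  rw [norm_mul_unitDir]; ring

/-- The unit radial field on a ray: `u_c(c + r v) = v` (`|v| = 1`, `r > 0`). [folklore] -/
theorem unitDir_ray {v : ℂ} (hv : ‖v‖ = 1) {r : ℝ} (hr : 0 < r) :
    unitDir c (c + (r : ℂ) * v) = v := by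
  have h1 : c + (r : ℂ) * v - c = (r : ℂ) * v := by ring
  rw [unitDir, h1, norm_mul, Complex.norm_real, Real.norm_of_nonneg hr.le, hv, mul_one, ← mul_assoc,
    ← Complex.ofReal_mul, inv_mul_cancel₀ hr.ne', Complex.ofReal_one, one_mul]

/-- The unit radial field is smooth off the centre. [folklore] -/
theorem contDiffAt_unitDir (h : z ≠ c) {n : WithTop ℕ∞} : ContDiffAt ℝ n (unitDir c) z := by
  have hsub : ContDiffAt ℝ n (fun z : ℂ ↦ z - c) z := contDiffAt_id.sub contDiffAt_const
  have hnorm : ContDiffAt ℝ n (fun z : ℂ ↦ ‖z - c‖) z := hsub.norm ℝ (sub_ne_zero.2 h)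
  have hinv : ContDiffAt ℝ n (fun z : ℂ ↦ ‖z - c‖⁻¹) z :=
    hnorm.inv (norm_ne_zero_iff.2 (sub_ne_zero.2 h))
  exact (Complex.ofRealCLM.contDiff.comp_contDiffAt z hinv).mul hsub

/-- **The derivative of the norm along a line**: `d/dt |A + tB| = ⟨A, B⟩/|A|` at `t = 0`
(`A ≠ 0`), with `⟨A, B⟩ = Re (B conj A)`. [folklore] -/
theorem hasDerivAt_norm_line {A : ℂ} (hA : A ≠ 0) (B : ℂ) :
    HasDerivAt (fun t : ℝ ↦ ‖A + (t : ℂ) * B‖) ((B * conj A).re / ‖A‖) 0 := by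
  have hl : HasDerivAt (fun t : ℝ ↦ A + (t : ℂ) * B) B 0 := by
    have := ((hasDerivAt_id (0 : ℝ)).ofReal_comp.mul_const B).const_add A
    simpa using this
  have h2 : HasDerivAt (fun t : ℝ ↦ ‖A + (t : ℂ) * B‖ ^ 2) (2 * inner ℝ (A + ((0 : ℝ) : ℂ) * B) B) 0 :=
    hl.norm_sq
  simp only [Complex.ofReal_zero, zero_mul, add_zero, Complex.inner] at h2
  have hA0 : ‖A‖ ^ 2 ≠ 0 := pow_ne_zero 2 (norm_ne_zero_iff.2 hA)
  have h3 := h2.sqrt (by simpa using hA0)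
  have hfun : (fun t : ℝ ↦ Real.sqrt (‖A + (t : ℂ) * B‖ ^ 2)) = fun t : ℝ ↦ ‖A + (t : ℂ) * B‖ :=
    funext fun t ↦ Real.sqrt_sq (norm_nonneg _)
  rw [hfun] at h3
  simp only [Complex.ofReal_zero, zero_mul, add_zero, Real.sqrt_sq (norm_nonneg A)] at h3
  refine h3.congr_deriv ?_
  have hApos : 0 < ‖A‖ := norm_pos_iff.2 hA
  field_simp

/-- **The derivative of the unit radial field along a line**:
`d/dt u_c(z + tB) = B/|A| − (⟨A, B⟩/|A|³) A` at `t = 0`, `A = z − c ≠ 0`. [folklore] -/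
theorem hasDerivAt_unitDir_line (h : z ≠ c) (B : ℂ) :
    HasDerivAt (fun t : ℝ ↦ unitDir c (z + (t : ℂ) * B))
      (((‖z - c‖⁻¹ : ℝ) : ℂ) * B - (((B * conj (z - c)).re / ‖z - c‖ ^ 3 : ℝ) : ℂ) * (z - c)) 0 := by
  set A : ℂ := z - c with hA
  have hA0 : A ≠ 0 := sub_ne_zero.2 h
  have hApos : 0 < ‖A‖ := norm_pos_iff.2 hA0
  have hrew : ∀ t : ℝ, z + (t : ℂ) * B - c = A + (t : ℂ) * B := fun t ↦ by rw [hA]; ring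
  have hfun : (fun t : ℝ ↦ unitDir c (z + (t : ℂ) * B)) =
      fun t : ℝ ↦ (((‖A + (t : ℂ) * B‖⁻¹ : ℝ)) : ℂ) * (A + (t : ℂ) * B) := by
    funext t; rw [unitDir, hrew]
  rw [hfun]
  have hn := (hasDerivAt_norm_line hA0 B).inv (by simpa using hApos.ne')
  have hl : HasDerivAt (fun t : ℝ ↦ A + (t : ℂ) * B) B 0 := by
    have := ((hasDerivAt_id (0 : ℝ)).ofReal_comp.mul_const B).const_add A
    simpa using this
  have h := hn.ofReal_comp.mul hl
  have h' : HasDerivAt (fun t : ℝ ↦ (((‖A + (t : ℂ) * B‖⁻¹ : ℝ)) : ℂ) * (A + (t : ℂ) * B)) _ 0 := h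
  refine h'.congr_deriv ?_
  simp only [Pi.inv_apply, Complex.ofReal_zero, zero_mul, add_zero]
  have e1 : (-((B * conj A).re / ‖A‖) / ‖A‖ ^ 2 : ℝ) = -((B * conj A).re / ‖A‖ ^ 3) := by
    field_simp
  rw [e1]
  push_cast
  ring

/-- **The kernel of the derivative of `G · u_c`**: if `G' u + G u' = 0` with `u = A/|A|`,
`u' = B/|A| − (⟨A,B⟩/|A|³) A` (the line derivative of `t ↦ G(t) u_c(z + tB)`), `G ≠ 0`, then
`G' = 0` and `B` is radial: `B = (⟨A, B⟩/|A|²) A`. [folklore] -/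
theorem kernel_radial {A B : ℂ} (hA : A ≠ 0) {G G' : ℝ} (hG : G ≠ 0)
    (h : (G' : ℂ) * (((‖A‖⁻¹ : ℝ) : ℂ) * A) +
      (G : ℂ) * (((‖A‖⁻¹ : ℝ) : ℂ) * B - (((B * conj A).re / ‖A‖ ^ 3 : ℝ) : ℂ) * A) = 0) :
    G' = 0 ∧ B = (((B * conj A).re / ‖A‖ ^ 2 : ℝ) : ℂ) * A := by
  have hn : 0 < ‖A‖ := norm_pos_iff.2 hA
  have hAA : A * conj A = ((‖A‖ ^ 2 : ℝ) : ℂ) := by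
    rw [Complex.mul_conj, Complex.normSq_eq_norm_sq, Complex.ofReal_pow]
  set P : ℂ := B * conj A with hP
  -- multiply by `conj A`
  have h2 := congrArg (fun X : ℂ ↦ X * conj A) h
  simp only [zero_mul] at h2
  have h3 : (((G' * ‖A‖ : ℝ)) : ℂ) +
      (G : ℂ) * (((‖A‖⁻¹ : ℝ) : ℂ) * P - ((P.re / ‖A‖ : ℝ) : ℂ)) = 0 := by
    have e1 : (((G' * ‖A‖ : ℝ)) : ℂ) = (G' : ℂ) * ((‖A‖⁻¹ : ℝ) : ℂ) * ((‖A‖ ^ 2 : ℝ) : ℂ) := by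
      push_cast; field_simp
    have e2 : ((P.re / ‖A‖ : ℝ) : ℂ) = ((P.re / ‖A‖ ^ 3 : ℝ) : ℂ) * ((‖A‖ ^ 2 : ℝ) : ℂ) := by
      push_cast; field_simp
    rw [e1, e2, ← h2, ← hAA, hP]; ring
  -- real and imaginary parts
  have hre := congrArg Complex.re h3
  have him := congrArg Complex.im h3
  simp only [Complex.add_re, Complex.mul_re, Complex.ofReal_re, Complex.ofReal_im, Complex.sub_re,
    Complex.sub_im, Complex.mul_im, zero_mul, sub_zero, Complex.zero_re, add_zero,
    Complex.add_im, Complex.zero_im, zero_add] at hre him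
  have hG' : G' = 0 := by
    have e3 : ‖A‖⁻¹ * P.re - P.re / ‖A‖ = 0 := by rw [inv_mul_eq_div, sub_self]
    rw [e3, mul_zero, add_zero] at hre
    rcases mul_eq_zero.1 hre with h' | h'
    · exact h'
    · exact absurd h' hn.ne'
  refine ⟨hG', ?_⟩
  -- `Im (B conj A) = 0`
  have hIm : P.im = 0 := by
    rcases mul_eq_zero.1 him with h' | h'
    · exact absurd h' hG
    · rcases mul_eq_zero.1 h' with h'' | h''
      · exact absurd h'' (inv_ne_zero hn.ne')
      · exact h''
  -- so `B conj A` is real and `B |A|² = (B conj A) A`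
  have hreal : P = ((P.re : ℝ) : ℂ) := by
    apply Complex.ext <;> simp [hIm]
  have hBA : B * ((‖A‖ ^ 2 : ℝ) : ℂ) = ((P.re : ℝ) : ℂ) * A := by
    rw [← hAA, ← hreal, hP]; ring
  have hn2 : ((‖A‖ ^ 2 : ℝ) : ℂ) ≠ 0 := by exact_mod_cast (pow_ne_zero 2 hn.ne')
  calc B = B * ((‖A‖ ^ 2 : ℝ) : ℂ) / ((‖A‖ ^ 2 : ℝ) : ℂ) := by rw [mul_div_cancel_right₀ _ hn2]
    _ = ((P.re : ℝ) : ℂ) * A / ((‖A‖ ^ 2 : ℝ) : ℂ) := by rw [hBA]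
    _ = ((P.re / ‖A‖ ^ 2 : ℝ) : ℂ) * A := by push_cast; ring

/-! ## The core straightening map `Θᴬ` -/

/-- **The core straightening map** `Θᴬ(z, w) = ((ĝ(z) + |w|²) u_c(z), w)` of the potential `ĝ`
about the centre `c`. [folklore] -/
def thetaA (c : ℂ) (ĝ : ℂ → ℝ) (p : ℂ × ℂ) : ℂ × ℂ :=
  (((ĝ p.1 + ‖p.2‖ ^ 2 : ℝ) : ℂ) * unitDir c p.1, p.2)

variable {ĝ : ℂ → ℝ}

/-- `Θᴬ` is smooth where `ĝ` is (off the centre). [folklore] -/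
theorem contDiffAt_thetaA {p : ℂ × ℂ} (hp : p.1 ≠ c) {n : WithTop ℕ∞} (hg : ContDiffAt ℝ n ĝ p.1) :
    ContDiffAt ℝ n (thetaA c ĝ) p := by
  have h1 : ContDiffAt ℝ n (fun p : ℂ × ℂ ↦ ĝ p.1 + ‖p.2‖ ^ 2) p :=
    (hg.comp p contDiffAt_fst).add ((contDiffAt_snd (𝕜 := ℝ)).norm_sq ℝ)
  have h2 : ContDiffAt ℝ n (fun p : ℂ × ℂ ↦ unitDir c p.1) p :=
    (contDiffAt_unitDir hp).comp p contDiffAt_fst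
  exact ((Complex.ofRealCLM.contDiff.comp_contDiffAt p h1).mul h2).prodMk contDiffAt_snd

/-- The radial derivative of `ĝ` read off the Fréchet derivative: if `r ↦ ĝ(c + r u_c(z))` has
derivative `d` at `r = |z − c|` then `ĝ'(z)(z − c) = |z − c| d`. [folklore] -/
theorem fderiv_apply_sub_centre {ĝ' : ℂ →L[ℝ] ℝ} (hĝ : HasFDerivAt ĝ ĝ' z) {d : ℝ}
    (hd : HasDerivAt (fun r : ℝ ↦ ĝ (c + (r : ℂ) * unitDir c z)) d ‖z - c‖) :
    ĝ' (z - c) = ‖z - c‖ * d := by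
  -- the line through `z` in the direction `u`
  have h1 := hasDerivAt_comp_line hĝ (unitDir c z)
  have hshift : HasDerivAt (fun t : ℝ ↦ ĝ (c + ((‖z - c‖ + t : ℝ) : ℂ) * unitDir c z)) d 0 := by
    have hd0 : HasDerivAt (fun r : ℝ ↦ ĝ (c + (r : ℂ) * unitDir c z)) d (‖z - c‖ + 0) := by
      rw [add_zero]; exact hd
    exact hd0.comp_const_add ‖z - c‖ 0
  have hfun : (fun t : ℝ ↦ ĝ (z + t • unitDir c z)) =
      fun t : ℝ ↦ ĝ (c + ((‖z - c‖ + t : ℝ) : ℂ) * unitDir c z) := by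
    funext t
    congr 1
    rw [Complex.real_smul, Complex.ofReal_add, add_mul, norm_mul_unitDir]; ring
  rw [hfun] at h1
  have heq : ĝ' (unitDir c z) = d := h1.unique hshift
  have hzc : z - c = ((‖z - c‖ : ℝ) : ℂ) * unitDir c z := (norm_mul_unitDir c z).symm
  calc ĝ' (z - c) = ĝ' ((‖z - c‖ : ℝ) • unitDir c z) := by rw [Complex.real_smul, ← hzc]
    _ = ‖z - c‖ * ĝ' (unitDir c z) := by rw [map_smul, smul_eq_mul]
    _ = ‖z - c‖ * d := by rw [heq]

/-- **The derivative of `Θᴬ` is injective** at `(z, w)`, `z ≠ c`, provided `ĝ(z) + |w|² ≠ 0`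
and the radial derivative of `ĝ` at `z` does not vanish. [folklore] -/
theorem injective_fderiv_thetaA {w : ℂ} (hz : z ≠ c) (hG : ĝ z + ‖w‖ ^ 2 ≠ 0) {ĝ' : ℂ →L[ℝ] ℝ}
    (hĝ : HasFDerivAt ĝ ĝ' z) (hrad : ĝ' (z - c) ≠ 0)
    (hdiff : DifferentiableAt ℝ (thetaA c ĝ) (z, w)) :
    Injective (fderiv ℝ (thetaA c ĝ) (z, w)) := by
  refine injective_of_hasDerivAt_line hdiff.hasFDerivAt fun v hv ↦ ?_
  obtain ⟨B, D⟩ := v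
  set A : ℂ := z - c with hA
  have hA0 : A ≠ 0 := sub_ne_zero.2 hz
  -- compute the line derivative of both components
  have hlineZ : ∀ t : ℝ, ((z, w) + t • (B, D)).1 = z + (t : ℂ) * B := fun t ↦ by
    simp [Complex.real_smul]
  have hlineW : ∀ t : ℝ, ((z, w) + t • (B, D)).2 = w + (t : ℂ) * D := fun t ↦ by
    simp [Complex.real_smul]
  -- the scalar factor `G(t) = ĝ(z + tB) + ‖w + tD‖²`
  have hGd : HasDerivAt (fun t : ℝ ↦ ĝ (z + (t : ℂ) * B) + ‖w + (t : ℂ) * D‖ ^ 2)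
      (ĝ' B + 2 * (D * conj w).re) 0 := by
    have h1 := hasDerivAt_comp_line hĝ B
    simp only [Complex.real_smul] at h1
    have hl : HasDerivAt (fun t : ℝ ↦ w + (t : ℂ) * D) D 0 := by
      have := ((hasDerivAt_id (0 : ℝ)).ofReal_comp.mul_const D).const_add w
      simpa using this
    have h2 : HasDerivAt (fun t : ℝ ↦ ‖w + (t : ℂ) * D‖ ^ 2) (2 * inner ℝ (w + ((0 : ℝ) : ℂ) * D) D) 0 :=
      hl.norm_sq
    simp only [Complex.ofReal_zero, zero_mul, add_zero, Complex.inner] at h2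
    exact h1.add h2
  have hU := hasDerivAt_unitDir_line hz B
  -- first component
  have hfst : HasDerivAt (fun t : ℝ ↦ (thetaA c ĝ ((z, w) + t • (B, D))).1)
      (((ĝ' B + 2 * (D * conj w).re : ℝ) : ℂ) * (((‖A‖⁻¹ : ℝ) : ℂ) * A) +
        ((ĝ z + ‖w‖ ^ 2 : ℝ) : ℂ) *
          (((‖A‖⁻¹ : ℝ) : ℂ) * B - (((B * conj A).re / ‖A‖ ^ 3 : ℝ) : ℂ) * A)) 0 := by
    have hf : (fun t : ℝ ↦ (thetaA c ĝ ((z, w) + t • (B, D))).1) = fun t : ℝ ↦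
        ((ĝ (z + (t : ℂ) * B) + ‖w + (t : ℂ) * D‖ ^ 2 : ℝ) : ℂ) * unitDir c (z + (t : ℂ) * B) := by
      funext t; simp only [thetaA, hlineZ, hlineW]
    rw [hf]
    have h := hGd.ofReal_comp.mul hU
    simp only [Complex.ofReal_zero, zero_mul, add_zero] at h
    have hu0 : unitDir c z = ((‖A‖⁻¹ : ℝ) : ℂ) * A := by rw [unitDir, hA]
    rw [hu0] at h
    exact h
  -- second component
  have hsnd : HasDerivAt (fun t : ℝ ↦ (thetaA c ĝ ((z, w) + t • (B, D))).2) D 0 := by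
    have hf : (fun t : ℝ ↦ (thetaA c ĝ ((z, w) + t • (B, D))).2) = fun t : ℝ ↦ w + (t : ℂ) * D := by
      funext t; simp only [thetaA, hlineW]
    rw [hf]
    have := ((hasDerivAt_id (0 : ℝ)).ofReal_comp.mul_const D).const_add w
    simpa using this
  -- compare with the vanishing derivative
  have hboth := hfst.prodMk hsnd
  have hfun : (fun t : ℝ ↦ ((thetaA c ĝ ((z, w) + t • (B, D))).1,
      (thetaA c ĝ ((z, w) + t • (B, D))).2)) = fun t : ℝ ↦ thetaA c ĝ ((z, w) + t • (B, D)) :=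
    funext fun t ↦ Prod.mk.eta
  rw [hfun] at hboth
  have heq := hboth.unique hv
  rw [Prod.ext_iff] at heq
  obtain ⟨h1, h2⟩ := heq
  simp only [Prod.fst_zero, Prod.snd_zero] at h1 h2
  -- `D = 0`, then the kernel lemma
  subst h2
  simp only [mul_zero, Complex.zero_re, add_zero, zero_mul] at h1
  obtain ⟨hG'0, hB⟩ := kernel_radial hA0 hG h1
  -- `B` is radial and `ĝ' B = 0` force `B = 0`
  have hB' : B = ((B * conj A).re / ‖A‖ ^ 2 : ℝ) • A := by rw [Complex.real_smul]; exact hB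
  have hlin : ĝ' B = ((B * conj A).re / ‖A‖ ^ 2) * ĝ' A := by
    conv_lhs => rw [hB']
    rw [map_smul, smul_eq_mul]
  rw [hlin] at hG'0
  rcases mul_eq_zero.1 hG'0 with h0 | h0
  · rw [h0] at hB'
    simp only [zero_smul] at hB'
    rw [hB']
    rfl
  · exact absurd h0 hrad

/-! ## The collar and the straightening theorem -/

/-- The open annulus `a₁ < |z − c| < a₂`. [folklore] -/
def annulus (c : ℂ) (a₁ a₂ : ℝ) : Set ℂ := {z | a₁ < ‖z - c‖ ∧ ‖z - c‖ < a₂}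

/-- The core collar `{a₁ < |z − c| < a₂} × {|w| < m₀}`. [folklore] -/
def collarA (c : ℂ) (a₁ a₂ m₀ : ℝ) : Set (ℂ × ℂ) := {p | p.1 ∈ annulus c a₁ a₂ ∧ ‖p.2‖ < m₀}

variable {a₁ a₂ m₀ : ℝ}

/-- The annulus is open. [folklore] -/
theorem isOpen_annulus (c : ℂ) (a₁ a₂ : ℝ) : IsOpen (annulus c a₁ a₂) := by
  have hc : Continuous fun z : ℂ ↦ ‖z - c‖ := by fun_prop
  exact (isOpen_lt continuous_const hc).inter (isOpen_lt hc continuous_const)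

/-- The core collar is open. [folklore] -/
theorem isOpen_collarA (c : ℂ) (a₁ a₂ m₀ : ℝ) : IsOpen (collarA c a₁ a₂ m₀) :=
  ((isOpen_annulus c a₁ a₂).preimage continuous_fst).inter
    (isOpen_lt (continuous_norm.comp continuous_snd) continuous_const)

/-- Points of the annulus are off the centre (`a₁ ≥ 0`). [folklore] -/
theorem ne_centre_of_mem_annulus (ha : 0 ≤ a₁) (hz : z ∈ annulus c a₁ a₂) : z ≠ c := by
  intro h
  have := hz.1
  rw [h, sub_self, norm_zero] at this
  linarith

/-- **Radial strict monotonicity** from the sign of the radial derivative: `r ↦ ĝ(c + r v)` is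
strictly decreasing on `(a₁, a₂)`. [folklore] -/
theorem strictAntiOn_ray
    (hrad : ∀ v : ℂ, ‖v‖ = 1 → ∀ r, a₁ < r → r < a₂ →
      ∃ d < 0, HasDerivAt (fun r : ℝ ↦ ĝ (c + (r : ℂ) * v)) d r)
    {v : ℂ} (hv : ‖v‖ = 1) : StrictAntiOn (fun r : ℝ ↦ ĝ (c + (r : ℂ) * v)) (Ioo a₁ a₂) := by
  have hcont : ContinuousOn (fun r : ℝ ↦ ĝ (c + (r : ℂ) * v)) (Ioo a₁ a₂) := fun r hr ↦
    (hrad v hv r hr.1 hr.2).choose_spec.2.continuousAt.continuousWithinAt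
  refine strictAntiOn_of_deriv_neg (convex_Ioo a₁ a₂) hcont fun r hr ↦ ?_
  rw [interior_Ioo] at hr
  obtain ⟨d, hdneg, hd⟩ := hrad v hv r hr.1 hr.2
  rwa [hd.deriv]

/-- The first component of `Θᴬ` has norm `ĝ + |w|²` (when this is nonnegative) and direction
`u_c`. [folklore] -/
theorem norm_thetaA_fst {p : ℂ × ℂ} (hp : p.1 ≠ c) (hG : 0 ≤ ĝ p.1 + ‖p.2‖ ^ 2) :
    ‖(thetaA c ĝ p).1‖ = ĝ p.1 + ‖p.2‖ ^ 2 := by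
  rw [thetaA, norm_mul, Complex.norm_real, Real.norm_of_nonneg hG, norm_unitDir hp, mul_one]

/-- **`Θᴬ` is injective on the collar** (all `w`): the direction of the first component is
`u_c(z)`, its norm is `ĝ(z) + |w|²`, and `ĝ` is strictly monotone along rays. [folklore] -/
theorem injOn_thetaA (ha : 0 ≤ a₁)
    (hgp : ∀ z ∈ annulus c a₁ a₂, 0 < ĝ z)
    (hrad : ∀ v : ℂ, ‖v‖ = 1 → ∀ r, a₁ < r → r < a₂ →
      ∃ d < 0, HasDerivAt (fun r : ℝ ↦ ĝ (c + (r : ℂ) * v)) d r) :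
    InjOn (thetaA c ĝ) {p : ℂ × ℂ | p.1 ∈ annulus c a₁ a₂} := by
  rintro ⟨z, w⟩ hz ⟨z', w'⟩ hz' h
  simp only [mem_setOf_eq] at hz hz'
  have hzc : z ≠ c := ne_centre_of_mem_annulus ha hz
  have hzc' : z' ≠ c := ne_centre_of_mem_annulus ha hz'
  simp only [thetaA, Prod.mk.injEq] at h
  obtain ⟨h1, rfl⟩ := h
  have hG : 0 < ĝ z + ‖w‖ ^ 2 := by have := hgp z hz; positivity
  have hG' : 0 < ĝ z' + ‖w‖ ^ 2 := by have := hgp z' hz'; positivity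
  -- norms: `G = G'`
  have hnorm := congrArg (fun X : ℂ ↦ ‖X‖) h1
  simp only [norm_mul, Complex.norm_real, Real.norm_of_nonneg hG.le, Real.norm_of_nonneg hG'.le,
    norm_unitDir hzc, norm_unitDir hzc', mul_one] at hnorm
  -- directions: `u = u'`
  have hu : unitDir c z = unitDir c z' := by
    rw [hnorm] at h1
    exact mul_left_cancel₀ (by exact_mod_cast hG'.ne') h1
  -- radii, by strict monotonicity along the common ray
  have hg : ĝ z = ĝ z' := by linarith
  have hzr : z = c + ((‖z - c‖ : ℝ) : ℂ) * unitDir c z' := by rw [← hu]; exact eq_centre_add_norm_mul_unitDir c z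
  have hzr' : z' = c + ((‖z' - c‖ : ℝ) : ℂ) * unitDir c z' := eq_centre_add_norm_mul_unitDir c z'
  have hmono := strictAntiOn_ray hrad (norm_unitDir hzc')
  have hr : ‖z - c‖ = ‖z' - c‖ := by
    apply hmono.injOn hz hz'
    show ĝ (c + ((‖z - c‖ : ℝ) : ℂ) * unitDir c z') = ĝ (c + ((‖z' - c‖ : ℝ) : ℂ) * unitDir c z')
    rw [← hzr, ← hzr', hg]
  have hzz : z = z' :=
    calc z = c + ((‖z - c‖ : ℝ) : ℂ) * unitDir c z' := hzr
      _ = c + ((‖z' - c‖ : ℝ) : ℂ) * unitDir c z' := by rw [hr]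
      _ = z' := hzr'.symm
  rw [hzz]

/-- **The derivative of `Θᴬ` is injective on the collar.** [folklore] -/
theorem injective_fderiv_thetaA_of_mem (ha : 0 ≤ a₁)
    (hsm : ∀ z ∈ annulus c a₁ a₂, ContDiffAt ℝ ∞ ĝ z)
    (hgp : ∀ z ∈ annulus c a₁ a₂, 0 < ĝ z)
    (hrad : ∀ v : ℂ, ‖v‖ = 1 → ∀ r, a₁ < r → r < a₂ →
      ∃ d < 0, HasDerivAt (fun r : ℝ ↦ ĝ (c + (r : ℂ) * v)) d r)
    {p : ℂ × ℂ} (hp : p.1 ∈ annulus c a₁ a₂) : Injective (fderiv ℝ (thetaA c ĝ) p) := by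
  obtain ⟨z, w⟩ := p
  simp only at hp
  have hzc : z ≠ c := ne_centre_of_mem_annulus ha hp
  have hG : ĝ z + ‖w‖ ^ 2 ≠ 0 := by have := hgp z hp; positivity
  have hĝ : HasFDerivAt ĝ (fderiv ℝ ĝ z) z :=
    ((hsm z hp).differentiableAt (by simp)).hasFDerivAt
  obtain ⟨d, hdneg, hd⟩ := hrad (unitDir c z) (norm_unitDir hzc) ‖z - c‖ hp.1 hp.2
  have hrad' : fderiv ℝ ĝ z (z - c) ≠ 0 := by
    rw [fderiv_apply_sub_centre hĝ hd]
    exact mul_ne_zero (norm_ne_zero_iff.2 (sub_ne_zero.2 hzc)) hdneg.ne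
  have hdiff : DifferentiableAt ℝ (thetaA c ĝ) (z, w) :=
    (contDiffAt_thetaA (p := (z, w)) hzc (hsm z hp)).differentiableAt (by simp)
  exact injective_fderiv_thetaA hzc hG hĝ hrad' hdiff

/-- **The core straightening theorem**: `Θᴬ` maps the core collar onto an OPEN set, with a
smooth inverse. [cite: LeeSmoothManifolds2013, Thm. 4.5] -/
theorem thetaA_straighten (ha : 0 ≤ a₁)
    (hsm : ∀ z ∈ annulus c a₁ a₂, ContDiffAt ℝ ∞ ĝ z)
    (hgp : ∀ z ∈ annulus c a₁ a₂, 0 < ĝ z)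
    (hrad : ∀ v : ℂ, ‖v‖ = 1 → ∀ r, a₁ < r → r < a₂ →
      ∃ d < 0, HasDerivAt (fun r : ℝ ↦ ĝ (c + (r : ℂ) * v)) d r) (m₀ : ℝ) :
    IsOpen (thetaA c ĝ '' collarA c a₁ a₂ m₀) ∧
      ContDiffOn ℝ ∞ (invFunOn (thetaA c ĝ) (collarA c a₁ a₂ m₀))
        (thetaA c ĝ '' collarA c a₁ a₂ m₀) := by
  refine isOpen_image_and_contDiffOn_invFunOn (isOpen_collarA c a₁ a₂ m₀) ?_ ?_ ?_
  · exact fun p hp ↦ (contDiffAt_thetaA (ne_centre_of_mem_annulus ha hp.1)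
      (hsm p.1 hp.1)).contDiffWithinAt
  · exact (injOn_thetaA ha hgp hrad).mono fun p hp ↦ hp.1
  · exact fun p hp ↦ injective_fderiv_thetaA_of_mem ha hsm hgp hrad hp.1

/-! ## The level hypersurface in the straightened picture -/

/-- On the collar, `ĝ(z) + |w|² = 1` iff the first component of `Θᴬ` is a unit vector.
[folklore] -/
theorem level_iff_norm_thetaA_fst (ha : 0 ≤ a₁) (hgp : ∀ z ∈ annulus c a₁ a₂, 0 < ĝ z)
    {p : ℂ × ℂ} (hp : p.1 ∈ annulus c a₁ a₂) :
    ĝ p.1 + ‖p.2‖ ^ 2 = 1 ↔ ‖(thetaA c ĝ p).1‖ = 1 := by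
  have hG : 0 ≤ ĝ p.1 + ‖p.2‖ ^ 2 := by have := hgp p.1 hp; positivity
  rw [norm_thetaA_fst (ne_centre_of_mem_annulus ha hp) hG]

/-- On the level hypersurface `Θᴬ(z, w) = (u_c(z), w)`. [folklore] -/
theorem thetaA_of_level {p : ℂ × ℂ} (h : ĝ p.1 + ‖p.2‖ ^ 2 = 1) :
    thetaA c ĝ p = (unitDir c p.1, p.2) := by
  simp [thetaA, h]

/-- The inverse returns to the collar. [folklore] -/
theorem invFunOn_thetaA_mem {q : ℂ × ℂ} (hq : q ∈ thetaA c ĝ '' collarA c a₁ a₂ m₀) :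
    invFunOn (thetaA c ĝ) (collarA c a₁ a₂ m₀) q ∈ collarA c a₁ a₂ m₀ :=
  invFunOn_mem (by simpa [mem_image] using hq)

/-- `Θᴬ ∘ (Θᴬ)⁻¹ = id` on the image. [folklore] -/
theorem thetaA_invFunOn {q : ℂ × ℂ} (hq : q ∈ thetaA c ĝ '' collarA c a₁ a₂ m₀) :
    thetaA c ĝ (invFunOn (thetaA c ĝ) (collarA c a₁ a₂ m₀) q) = q :=
  invFunOn_eq (by simpa [mem_image] using hq)

/-- `(Θᴬ)⁻¹ ∘ Θᴬ = id` on the collar. [folklore] -/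
theorem invFunOn_thetaA (ha : 0 ≤ a₁) (hgp : ∀ z ∈ annulus c a₁ a₂, 0 < ĝ z)
    (hrad : ∀ v : ℂ, ‖v‖ = 1 → ∀ r, a₁ < r → r < a₂ →
      ∃ d < 0, HasDerivAt (fun r : ℝ ↦ ĝ (c + (r : ℂ) * v)) d r)
    {p : ℂ × ℂ} (hp : p ∈ collarA c a₁ a₂ m₀) :
    invFunOn (thetaA c ĝ) (collarA c a₁ a₂ m₀) (thetaA c ĝ p) = p :=
  ((injOn_thetaA ha hgp hrad).mono fun _ hq ↦ hq.1).leftInvOn_invFunOn hp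

/-- **Coverage by the intermediate value theorem**: if along the ray of the unit vector `e` the
potential passes the level `1 − |w|²` between the radii `r₁ < r₂` of the annulus, then `(e, w)` is
in the image of the collar under `Θᴬ` (`|w| < m₀`). [folklore] -/
theorem mem_image_thetaA_of_ivt (ha : 0 ≤ a₁)
    (hrad : ∀ v : ℂ, ‖v‖ = 1 → ∀ r, a₁ < r → r < a₂ →
      ∃ d < 0, HasDerivAt (fun r : ℝ ↦ ĝ (c + (r : ℂ) * v)) d r)
    {e w : ℂ} (he : ‖e‖ = 1) (hw : ‖w‖ < m₀) {r₁ r₂ : ℝ} (h1 : a₁ < r₁) (h12 : r₁ ≤ r₂) (h2 : r₂ < a₂)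
    (hg1 : 1 - ‖w‖ ^ 2 ≤ ĝ (c + (r₁ : ℂ) * e)) (hg2 : ĝ (c + (r₂ : ℂ) * e) ≤ 1 - ‖w‖ ^ 2) :
    (e, w) ∈ thetaA c ĝ '' collarA c a₁ a₂ m₀ := by
  -- continuity on `[r₁, r₂]`
  have hcont : ContinuousOn (fun r : ℝ ↦ ĝ (c + (r : ℂ) * e)) (Icc r₁ r₂) := fun r hr ↦
    (hrad e he r (by linarith [hr.1]) (by linarith [hr.2])).choose_spec.2.continuousAt.continuousWithinAt
  -- intermediate value theorem (decreasing function)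
  have hmem : 1 - ‖w‖ ^ 2 ∈ Icc (ĝ (c + (r₂ : ℂ) * e)) (ĝ (c + (r₁ : ℂ) * e)) := ⟨hg2, hg1⟩
  obtain ⟨r, hr, hgr⟩ := intermediate_value_Icc' h12 hcont hmem
  refine ⟨(c + (r : ℂ) * e, w), ⟨⟨?_, ?_⟩, hw⟩, ?_⟩
  · show a₁ < ‖c + (r : ℂ) * e - c‖
    rw [add_sub_cancel_left, norm_mul, Complex.norm_real, he, mul_one,
      Real.norm_of_nonneg (by linarith [hr.1])]
    linarith [hr.1]
  · show ‖c + (r : ℂ) * e - c‖ < a₂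
    rw [add_sub_cancel_left, norm_mul, Complex.norm_real, he, mul_one,
      Real.norm_of_nonneg (by linarith [hr.1])]
    linarith [hr.2]
  · have hgr' : ĝ (c + (r : ℂ) * e) = 1 - ‖w‖ ^ 2 := hgr
    rw [thetaA_of_level (by show ĝ (c + (r : ℂ) * e) + ‖w‖ ^ 2 = 1; rw [hgr']; ring)]
    show (unitDir c (c + (r : ℂ) * e), w) = (e, w)
    rw [unitDir_ray he (by linarith [hr.1])]

end MMSW

end Literature.Topology.FourManifolds
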